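import Literature.AlgebraicGeometry.Frobenioids.PerfectionRootArrows
import Literature.AlgebraicGeometry.Frobenioids.PerfectionFunctorialityUnique
import Literature.AlgebraicGeometry.Frobenioids.PerfectionSquareFSM
import Literature.AlgebraicGeometry.Frobenioids.PreFrobenioidEquivalence
import HarnessLib

/-!
# Frobenioids I, Theorem 3.4 (iii), the perfection square: `1`-uniqueness of `Ψ^pf` among functors
# compatible with the Frobenioid structures (PROOFS)

Mochizuki, *The geometry of Frobenioids I: the general theory*, Kyushu J. Math. **62** (2008), Theorem
3.4 (iii), p. 62 l. 42 – p. 63 l. 2 [cite: MochizukiFrdI2008, Thm. 3.4 (iii) p.62]: "`Ψ` induces a `1`-unique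
functor `Ψ^pf : C₁^pf → C₂^pf` that fits into a `1`-commutative diagram [with `C_i → C_i^pf`]", printed proof
p. 64 ll. 26–28: "it follows immediately from the definition of `C^pf` [cf. Definition 3.1, (iii)] that we
obtain a `1`-unique `1`-commutative diagram".

WHAT IS PROVED.  For THE perfections `C_i^pf = Perfection hF_i` (seat abc-iut-L1-d9) and the functor
`Ψ^pf = Perfection.map hG` of `PerfectionFunctoriality.lean` (seat abc-iut-L1-d1): every functor
`B′ : C₁^pf ⥤ C₂^pf` which is COMPATIBLE WITH THE FROBENIOID STRUCTURES — `B′` carries arrows of Frobenius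
type of `C₁^pf` to arrows of Frobenius type of `C₂^pf` of the same Frobenius degree — and makes the square
with `C_i → C_i^pf` `1`-commute (`Ψ ⋙ (C₂ → C₂^pf) ≅ (C₁ → C₁^pf) ⋙ B′`) is isomorphic to `Ψ^pf`
(`map_unique_of_isFrobeniusCompatible`).  Here `Ψ = G` is ANY functor compatible with arrows of Frobenius
type (`IsFrobeniusCompatible`), `C₁` is an arbitrary Frobenioid (NO perfect-type hypothesis — contrast
`map_unique_of_isOfPerfectType`, `PerfectionFunctorialityUnique.lean`), and `C₂` is of Frobenius-isotropic
type (print's standing hypothesis for `C^pf`, Def. 3.1 (iii) p. 56 / Prop. 3.2 p. 58).  This is the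
structure-compatible reading of "`1`-unique" — the reading the printed proof establishes (abc-iut cell, typer
ruling T34pf-Q1 of seat abc-iut-L1-t3, GAP-LEDGER row G-L1d8-2): the BARE reading "unique among ALL functors
fitting the square" is false for non-perfect `C₁` (seat abc-iut-L1-d4).  Corollaries: the repaired
`1`-unique square `PfSquareR` (t3's shape, spelled out) for an equivalence `Ψ` compatible with arrows of
Frobenius type (`pfSquareR_map`), and its instance over FSM-type bases (`FrdI.thm34iii_pfSquareR_of_isOfFSMType`).

THE ARGUMENT (the printed "immediately from the definition of `C^pf`", made explicit; the single-Frobenioid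
bookkeeping is the companion file `PerfectionRootArrows.lean`).
* Root arrows.  For `X = (A, n)` and `a ≥ 1` the class `κ_{X,a} : (A, n) → (A^{(a)}, 1) = toPf (A^{(a)})` at
  level `(a, n·a)` of the chosen Frobenius arrow `A^{(a)} → (A^{(a)})^{(n·a)}` is of Frobenius type of degree
  `n·a`; every arrow `[θ : A^{(a)} → B^{(b)}] : (A, n) → (B, m)` of `C^pf` sits in the square
  `[θ] ≫ κ_{Y,b} = κ_{X,a} ≫ toPf θ` (`mk_comp_mkFrob`), and `κ_{X,a} = κ_{X,1} ≫ toPf (A^{(1)} → A^{(a)})`.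
* Monomorphisms.  A perfected morphism represented by an arrow of Frobenius type of `C` is a MONOMORPHISM
  of `C^pf` (`mono_mk_of_isFrobeniusType`, any Frobenioid) — the perfection kills the unit torsion that
  prevents arrows of Frobenius type from being monomorphisms in `C` itself.
* Objects (`exists_objIso`).  `B′ κ_{X,1}` followed by `ι : B′(A^{(1)}, 1) ≅ (Ψ A^{(1)}, 1)` and `Ψ^pf κ_{X,1}`
  are arrows of Frobenius type of degree `n` into `(Ψ A^{(1)}, 1)`; roots being unique in `C₂^pf`
  (`exists_iso_comp_powerMap`, Prop. 3.2 (iii)), `B′ X ≅ Ψ^pf X` compatibly with `κ_{X,1}`, hence with every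
  `κ_{X,a}` (`objIso_comp_map_mkFrob`).
* Naturality (`objIso_natural`): post-compose the naturality square of `[θ]` with the monomorphism
  `Ψ^pf κ_{Y,b}` and use the two root-arrow identities and the naturality of `ι` on `toPf θ`.
To keep every intermediate identity well-typed up to reducible unfolding, `Ψ^pf` is handled through its
defining data `Perfection.objMap` / `Perfection.repMap` (`Perfection.map_obj`, `Perfection.map_mk` are
`rfl`) and the isomorphism of the square through its components `ι_A`.
No new definitions; nothing here is specific to the abc programme.
-/

namespace Literature.AlgebraicGeometry.Frobenioids

namespace PreFrobenioid

namespace Perfection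

open CategoryTheory Opposite

universe w v v' u u' w₂ v₂ v₂' u₂ u₂'

section Unique

variable {D₁ : Type u} [Category.{v} D₁] {Φ₁ : D₁ᵒᵖ ⥤ CommMonCat.{w}}
  {C₁ : Type u'} [Category.{v'} C₁] {F₁ : C₁ ⥤ ElemFrobenioid Φ₁} {hF₁ : IsFrobenioid F₁}
  {D₂ : Type u₂} [Category.{v₂} D₂] {Φ₂ : D₂ᵒᵖ ⥤ CommMonCat.{w₂}}
  {C₂ : Type u₂'} [Category.{v₂'} C₂] {F₂ : C₂ ⥤ ElemFrobenioid Φ₂} {hF₂ : IsFrobenioid F₂}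
  {G : C₁ ⥤ C₂} (hG : IsFrobeniusCompatible F₁ F₂ G)

/-! ### `Ψ^pf` on representatives of Frobenius type -/

/-- `Ψ^pf` carries a representative of Frobenius type to a representative of Frobenius type (`Ψ` preserves
arrows of Frobenius type; the comparison isomorphisms `Ψ(A^{(a)}) ≅ (Ψ A)^{(a)}` are of Frobenius type).
[cite: MochizukiFrdI2008, Thm. 3.4 (iii) p.62] -/
theorem isFrobeniusType_repMap_hom {X Y : Perfection hF₁} (r : Rep X Y) (hr : IsFrobeniusType F₁ r.hom) :
    IsFrobeniusType F₂ (repMap (hF₁ := hF₁) (hF₂ := hF₂) hG r).hom := by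
  rw [repMap_hom]
  exact IsFrobeniusType.iso_comp hF₂.isPreFrobenioid _
    ((hG.isFrobeniusType_map _ hr).comp_iso hF₂.isPreFrobenioid _)

/-- … of the same Frobenius degree. [cite: MochizukiFrdI2008, Thm. 3.4 (iii) p.62] -/
theorem degFr_repMap_hom {X Y : Perfection hF₁} (r : Rep X Y) (hr : IsFrobeniusType F₁ r.hom) :
    PreFrobenioid.degFr F₂ (repMap (hF₁ := hF₁) (hF₂ := hF₂) hG r).hom = PreFrobenioid.degFr F₁ r.hom := by
  change PreFrobenioid.degFr F₂ ((frobPowIso (hF₁ := hF₁) (hF₂ := hF₂) hG X.obj r.L.a).inv ≫ G.map r.hom ≫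
    (frobPowIso (hF₁ := hF₁) (hF₂ := hF₂) hG Y.obj r.L.b).hom) = _
  rw [PreFrobenioid.degFr_comp, PreFrobenioid.degFr_comp, hG.degFr_map _ hr,
    show PreFrobenioid.degFr F₂ (frobPowIso (hF₁ := hF₁) (hF₂ := hF₂) hG X.obj r.L.a).inv = 1 from
      isLinear_of_isIso F₂ _,
    show PreFrobenioid.degFr F₂ (frobPowIso (hF₁ := hF₁) (hF₂ := hF₂) hG Y.obj r.L.b).hom = 1 from
      isLinear_of_isIso F₂ _, one_mul, mul_one]

/-! ### The objects: `B′ X ≅ Ψ^pf X`, compatibly with the root arrows -/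

variable (hiso₂ : IsOfType (IsFrobeniusIsotropic F₂)) (B' : Perfection hF₁ ⥤ Perfection hF₂)
  (h₁ : PreFrobenioidData.PreservesMor B' (ops hF₁).IsFrobeniusType (ops hF₂).IsFrobeniusType)
  (h₂ : ∀ ⦃X Y : Perfection hF₁⦄ (f : X ⟶ Y), (ops hF₁).IsFrobeniusType f →
    (ops hF₂).degFr (B'.map f) = (ops hF₁).degFr f)
  (ι : ∀ A : C₁, B'.obj ((toPf hF₁).obj A) ≅ (toPf hF₂).obj (G.obj A))
  (hι : ∀ ⦃A B : C₁⦄ (φ : A ⟶ B),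
    B'.map ((toPf hF₁).map φ) ≫ (ι B).hom = (ι A).hom ≫ (toPf hF₂).map (G.map φ))

include hiso₂ h₁ h₂ in
/-- **Objects.**  For `X = (A, n)`: `B′ κ_{X,1}` followed by `ι : B′(A^{(1)}, 1) ≅ (Ψ A^{(1)}, 1)` and
`Ψ^pf κ_{X,1}` are arrows of Frobenius type of degree `n` into `(Ψ A^{(1)}, 1)`; `n`-th roots being unique in
`C₂^pf` (`exists_iso_comp_powerMap`), both domains are isomorphic to `(Ψ A^{(1)}, 1·n)`, whence an isomorphism
`B′ X ≅ Ψ^pf X` compatible with `κ_{X,1}`. [cite: MochizukiFrdI2008, Thm. 3.4 (iii) p.62] -/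
theorem exists_objIso (X : Perfection hF₁) :
    ∃ j : B'.obj X ≅ objMap (hF₂ := hF₂) G X,
      j.hom ≫ (Hom.mk (repMap (hF₁ := hF₁) (hF₂ := hF₂) hG
          ⟨⟨1, X.idx, mul_comm _ _⟩, frob hF₁ (frobPow hF₁ X.obj 1) X.idx⟩) :
            objMap (hF₂ := hF₂) G X ⟶ objMap (hF₂ := hF₂) G (root hF₁ (frobPow hF₁ X.obj 1) 1)) =
        B'.map (Hom.mk ⟨⟨1, X.idx, mul_comm _ _⟩, frob hF₁ (frobPow hF₁ X.obj 1) X.idx⟩ :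
            X ⟶ root hF₁ (frobPow hF₁ X.obj 1) 1) ≫ (ι (frobPow hF₁ X.obj 1)).hom := by
  have hκ : (ops hF₁).IsFrobeniusType (X := X) (Y := root hF₁ (frobPow hF₁ X.obj 1) 1)
      (Hom.mk ⟨⟨1, X.idx, mul_comm _ _⟩, frob hF₁ (frobPow hF₁ X.obj 1) X.idx⟩) :=
    isFrobeniusType_mkFrob X 1 X.idx _
  have hκd : (ops hF₁).degFr (A := X) (B := root hF₁ (frobPow hF₁ X.obj 1) 1)
      (Hom.mk ⟨⟨1, X.idx, mul_comm _ _⟩, frob hF₁ (frobPow hF₁ X.obj 1) X.idx⟩) = X.idx :=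
    degFr_mkFrob X 1 X.idx _
  -- the `B′` side
  have hβ := isFrobeniusType_comp_isIso hiso₂ (h₁ _ hκ) (ι (frobPow hF₁ X.obj 1)).hom
  have hβd : (ops hF₂).degFr (B'.map (Hom.mk ⟨⟨1, X.idx, mul_comm _ _⟩, frob hF₁ (frobPow hF₁ X.obj 1) X.idx⟩ :
      X ⟶ root hF₁ (frobPow hF₁ X.obj 1) 1) ≫ (ι (frobPow hF₁ X.obj 1)).hom) = X.idx := by
    rw [degFr_comp_isIso_pf, h₂ _ hκ, hκd]
  obtain ⟨e₁, he₁, h₁e⟩ := exists_iso_comp_powerMap (hF := hF₂) hiso₂ (B := G.obj (frobPow hF₁ X.obj 1))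
    (m := 1) _ hβ hβd
  -- the `Ψ^pf` side
  have hμ : (ops hF₂).IsFrobeniusType (X := objMap (hF₂ := hF₂) G X)
      (Y := objMap (hF₂ := hF₂) G (root hF₁ (frobPow hF₁ X.obj 1) 1))
      (Hom.mk (repMap (hF₁ := hF₁) (hF₂ := hF₂) hG
        ⟨⟨1, X.idx, mul_comm _ _⟩, frob hF₁ (frobPow hF₁ X.obj 1) X.idx⟩)) :=
    isFrobeniusType_mk_of _ (isFrobeniusType_repMap_hom hG _ (isFrobeniusType_frob hF₁ _ _))
  have hμd : (ops hF₂).degFr (A := objMap (hF₂ := hF₂) G X)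
      (B := objMap (hF₂ := hF₂) G (root hF₁ (frobPow hF₁ X.obj 1) 1))
      (Hom.mk (repMap (hF₁ := hF₁) (hF₂ := hF₂) hG
        ⟨⟨1, X.idx, mul_comm _ _⟩, frob hF₁ (frobPow hF₁ X.obj 1) X.idx⟩)) = X.idx := by
    rw [degFr_mk_eq, degFr_repMap_hom hG _ (isFrobeniusType_frob hF₁ _ _), degFr_frob]
  obtain ⟨e₂, he₂, h₂e⟩ := exists_iso_comp_powerMap (hF := hF₂) hiso₂ (B := G.obj (frobPow hF₁ X.obj 1))
    (m := 1) _ hμ hμd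
  haveI := he₁
  haveI := he₂
  refine ⟨asIso e₁ ≪≫ (asIso e₂).symm, ?_⟩
  change (e₁ ≫ inv e₂) ≫ _ = _
  rw [← h₂e, Category.assoc, IsIso.inv_hom_id_assoc, h₁e]

include hι in
/-- An isomorphism `B′ X ≅ Ψ^pf X` compatible with `κ_{X,1}` is compatible with every root arrow `κ_{X,a}`
(`κ_{X,a} = κ_{X,1} ≫ toPf (A^{(1)} → A^{(a)})` and the naturality of `ι`).
[cite: MochizukiFrdI2008, Thm. 3.4 (iii) p.62] -/
theorem objIso_comp_map_mkFrob (X : Perfection hF₁) (j : B'.obj X ≅ objMap (hF₂ := hF₂) G X)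
    (hj : j.hom ≫ (Hom.mk (repMap (hF₁ := hF₁) (hF₂ := hF₂) hG
          ⟨⟨1, X.idx, mul_comm _ _⟩, frob hF₁ (frobPow hF₁ X.obj 1) X.idx⟩) :
            objMap (hF₂ := hF₂) G X ⟶ objMap (hF₂ := hF₂) G (root hF₁ (frobPow hF₁ X.obj 1) 1)) =
        B'.map (Hom.mk ⟨⟨1, X.idx, mul_comm _ _⟩, frob hF₁ (frobPow hF₁ X.obj 1) X.idx⟩ :
            X ⟶ root hF₁ (frobPow hF₁ X.obj 1) 1) ≫ (ι (frobPow hF₁ X.obj 1)).hom)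
    (a N : ℕ+) (h : X.idx * a = 1 * N) :
    j.hom ≫ (Hom.mk (repMap (hF₁ := hF₁) (hF₂ := hF₂) hG ⟨⟨a, N, h⟩, frob hF₁ (frobPow hF₁ X.obj a) N⟩) :
        objMap (hF₂ := hF₂) G X ⟶ objMap (hF₂ := hF₂) G (root hF₁ (frobPow hF₁ X.obj a) 1)) =
      B'.map (Hom.mk ⟨⟨a, N, h⟩, frob hF₁ (frobPow hF₁ X.obj a) N⟩ : X ⟶ root hF₁ (frobPow hF₁ X.obj a) 1) ≫
        (ι (frobPow hF₁ X.obj a)).hom := by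
  have e := mkFrob_eq_mkFrob_one_comp X a N h (mul_comm _ _)
  -- the same identity after `Ψ^pf`
  have e' := congrArg (map (hF₁ := hF₁) (hF₂ := hF₂) hG).map e
  rw [Functor.map_comp, map_toPf_map] at e'
  have e'' : (Hom.mk (repMap (hF₁ := hF₁) (hF₂ := hF₂) hG ⟨⟨a, N, h⟩, frob hF₁ (frobPow hF₁ X.obj a) N⟩) :
        objMap (hF₂ := hF₂) G X ⟶ objMap (hF₂ := hF₂) G (root hF₁ (frobPow hF₁ X.obj a) 1)) =
      (Hom.mk (repMap (hF₁ := hF₁) (hF₂ := hF₂) hG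
          ⟨⟨1, X.idx, mul_comm _ _⟩, frob hF₁ (frobPow hF₁ X.obj 1) X.idx⟩) :
            objMap (hF₂ := hF₂) G X ⟶ objMap (hF₂ := hF₂) G (root hF₁ (frobPow hF₁ X.obj 1) 1)) ≫
        (toPf hF₂).map (G.map (frobTrans hF₁ X.obj (one_dvd a))) := e'
  rw [e'', ← Category.assoc, hj, Category.assoc, ← hι, ← Category.assoc, ← B'.map_comp, ← e]

include hι in
/-- **Naturality core.**  Given object isomorphisms compatible with the root arrows `κ_{X,1}`, the family
is natural with respect to every perfected morphism `[θ]`: post-compose with the monomorphism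
`Ψ^pf κ_{Y,b}` and use `[θ] ≫ κ_{Y,b} = κ_{X,a} ≫ toPf θ` on both sides. [cite: MochizukiFrdI2008, Thm. 3.4 (iii) p.62] -/
theorem objIso_natural (j : ∀ X : Perfection hF₁, B'.obj X ≅ objMap (hF₂ := hF₂) G X)
    (hj : ∀ X : Perfection hF₁, (j X).hom ≫ (Hom.mk (repMap (hF₁ := hF₁) (hF₂ := hF₂) hG
          ⟨⟨1, X.idx, mul_comm _ _⟩, frob hF₁ (frobPow hF₁ X.obj 1) X.idx⟩) :
            objMap (hF₂ := hF₂) G X ⟶ objMap (hF₂ := hF₂) G (root hF₁ (frobPow hF₁ X.obj 1) 1)) =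
        B'.map (Hom.mk ⟨⟨1, X.idx, mul_comm _ _⟩, frob hF₁ (frobPow hF₁ X.obj 1) X.idx⟩ :
            X ⟶ root hF₁ (frobPow hF₁ X.obj 1) 1) ≫ (ι (frobPow hF₁ X.obj 1)).hom)
    {X Y : Perfection hF₁} (r : Rep X Y) :
    B'.map (Hom.mk r : X ⟶ Y) ≫ (j Y).hom =
      (j X).hom ≫ (Hom.mk (repMap (hF₁ := hF₁) (hF₂ := hF₂) hG r) : objMap (hF₂ := hF₂) G X ⟶ objMap G Y) := by
  -- the two root arrows at the common index `N = n·a = m·b`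
  have hX : X.idx * r.L.a = 1 * (X.idx * r.L.a) := (one_mul _).symm
  have hY : Y.idx * r.L.b = 1 * (X.idx * r.L.a) := by rw [one_mul, r.L.eq]
  have hjX := objIso_comp_map_mkFrob hG B' ι hι X (j X) (hj X) r.L.a (X.idx * r.L.a) hX
  have hjY := objIso_comp_map_mkFrob hG B' ι hι Y (j Y) (hj Y) r.L.b (X.idx * r.L.a) hY
  have sq := mk_comp_mkFrob r (X.idx * r.L.a) hX hY
  -- the same square after `Ψ^pf`
  have sq' := congrArg (map (hF₁ := hF₁) (hF₂ := hF₂) hG).map sq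
  rw [Functor.map_comp, Functor.map_comp, map_toPf_map] at sq'
  have sq'' : (Hom.mk (repMap (hF₁ := hF₁) (hF₂ := hF₂) hG r) : objMap (hF₂ := hF₂) G X ⟶ objMap G Y) ≫
      (Hom.mk (repMap (hF₁ := hF₁) (hF₂ := hF₂) hG
          ⟨⟨r.L.b, X.idx * r.L.a, hY⟩, frob hF₁ (frobPow hF₁ Y.obj r.L.b) (X.idx * r.L.a)⟩) :
        objMap (hF₂ := hF₂) G Y ⟶ objMap (hF₂ := hF₂) G (root hF₁ (frobPow hF₁ Y.obj r.L.b) 1)) =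
      (Hom.mk (repMap (hF₁ := hF₁) (hF₂ := hF₂) hG
          ⟨⟨r.L.a, X.idx * r.L.a, hX⟩, frob hF₁ (frobPow hF₁ X.obj r.L.a) (X.idx * r.L.a)⟩) :
        objMap (hF₂ := hF₂) G X ⟶ objMap (hF₂ := hF₂) G (root hF₁ (frobPow hF₁ X.obj r.L.a) 1)) ≫
        (toPf hF₂).map (G.map r.hom) := sq'
  -- cancel the monomorphism `Ψ^pf κ_{Y,b}`
  haveI := mono_mk_of_isFrobeniusType (hF := hF₂)
    (repMap (hF₁ := hF₁) (hF₂ := hF₂) hG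
      (⟨⟨r.L.b, X.idx * r.L.a, hY⟩, frob hF₁ (frobPow hF₁ Y.obj r.L.b) (X.idx * r.L.a)⟩ :
        Rep Y (root hF₁ (frobPow hF₁ Y.obj r.L.b) 1)))
    (isFrobeniusType_repMap_hom hG _ (isFrobeniusType_frob hF₁ _ _))
  rw [← cancel_mono (Hom.mk (repMap (hF₁ := hF₁) (hF₂ := hF₂) hG
      ⟨⟨r.L.b, X.idx * r.L.a, hY⟩, frob hF₁ (frobPow hF₁ Y.obj r.L.b) (X.idx * r.L.a)⟩) :
    objMap (hF₂ := hF₂) G Y ⟶ objMap (hF₂ := hF₂) G (root hF₁ (frobPow hF₁ Y.obj r.L.b) 1)),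
    Category.assoc, hjY, ← B'.map_comp_assoc, sq, B'.map_comp_assoc, hι, ← Category.assoc, ← hjX,
    Category.assoc, Category.assoc, sq'']

include hiso₂ h₁ h₂ in
/-- **Theorem 3.4 (iii), `1`-uniqueness of `Ψ^pf` among functors compatible with the Frobenioid structures**
(print's meaning of "`1`-unique"; no perfect-type hypothesis on `C₁`): for THE perfections, a functor
`Ψ : C₁ → C₂` compatible with arrows of Frobenius type and `C₂` of Frobenius-isotropic type, every
`B′ : C₁^pf ⥤ C₂^pf` which carries arrows of Frobenius type to arrows of Frobenius type of the same degree and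
satisfies `Ψ ⋙ (C₂ → C₂^pf) ≅ (C₁ → C₁^pf) ⋙ B′` is isomorphic to `Ψ^pf = Perfection.map`.
[cite: MochizukiFrdI2008, Thm. 3.4 (iii) p.62] -/
theorem map_unique_of_isFrobeniusCompatible (h : OneCommutes G (toPf hF₂) (toPf hF₁) B') :
    Nonempty (B' ≅ map (hF₁ := hF₁) (hF₂ := hF₂) hG) := by
  obtain ⟨i⟩ := h
  obtain ⟨ι, hι⟩ : ∃ ι : ∀ A : C₁, B'.obj ((toPf hF₁).obj A) ≅ (toPf hF₂).obj (G.obj A),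
      ∀ ⦃A B : C₁⦄ (φ : A ⟶ B), B'.map ((toPf hF₁).map φ) ≫ (ι B).hom = (ι A).hom ≫ (toPf hF₂).map (G.map φ) :=
    ⟨fun A => (i.app A).symm, fun A B φ => i.inv.naturality φ⟩
  have hj := fun X => exists_objIso hG hiso₂ B' h₁ h₂ ι X
  choose j hj using hj
  exact ⟨NatIso.ofComponents j fun {X Y} f => by
    obtain ⟨r, rfl⟩ := Hom.mk_surjective f
    exact objIso_natural hG B' ι hι j hj r⟩

include hiso₂ in
/-- **The repaired `1`-unique perfection square** (`PfSquareR`, typer shape of seat abc-iut-L1-t3) for THE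
perfections and an equivalence `Ψ` compatible with arrows of Frobenius type, `C₂` of Frobenius-isotropic
type: `Ψ^pf` is an equivalence, `Ψ ⋙ (C₂ → C₂^pf) ≅ (C₁ → C₁^pf) ⋙ Ψ^pf`, and `Ψ^pf` is unique up to
isomorphism among the functors compatible with the Frobenioid structures that fit into the square.
[cite: MochizukiFrdI2008, Thm. 3.4 (iii) p.62] -/
theorem pfSquareR_map (Ψ : C₁ ≌ C₂) (hΨ : IsFrobeniusCompatible F₁ F₂ Ψ.functor) :
    (map (hF₁ := hF₁) (hF₂ := hF₂) hΨ).IsEquivalence ∧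
      OneCommutes Ψ.functor (toPf hF₂) (toPf hF₁) (map (hF₁ := hF₁) (hF₂ := hF₂) hΨ) ∧
      ∀ B' : Perfection hF₁ ⥤ Perfection hF₂,
        PreFrobenioidData.PreservesMor B' (ops hF₁).IsFrobeniusType (ops hF₂).IsFrobeniusType →
        (∀ ⦃X Y : Perfection hF₁⦄ (f : X ⟶ Y), (ops hF₁).IsFrobeniusType f →
          (ops hF₂).degFr (B'.map f) = (ops hF₁).degFr f) →
        OneCommutes Ψ.functor (toPf hF₂) (toPf hF₁) B' → Nonempty (B' ≅ map (hF₁ := hF₁) (hF₂ := hF₂) hΨ) :=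
  ⟨map_isEquivalence Ψ hΨ, ⟨(toPfCompMapIso hΨ).symm⟩,
    fun B' h₁ h₂ h => map_unique_of_isFrobeniusCompatible hΨ hiso₂ B' h₁ h₂ h⟩

end Unique


end Perfection

end PreFrobenioid

/-! ### Over FSM-type bases (the cell's repaired hypothesis set of Thm. 3.4 (iii)) -/

namespace FrdI

open CategoryTheory

universe w v v' u u'

variable {D₁ : Type u} [Category.{v} D₁] {Φ₁ : D₁ᵒᵖ ⥤ CommMonCat.{w}} {C₁ : Type u'}
  [Category.{v'} C₁] {D₂ : Type u} [Category.{v} D₂] {Φ₂ : D₂ᵒᵖ ⥤ CommMonCat.{w}} {C₂ : Type u'}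
  [Category.{v'} C₂] {F₁ : C₁ ⥤ ElemFrobenioid Φ₁} {F₂ : C₂ ⥤ ElemFrobenioid Φ₂}

/-- **Theorem 3.4 (iii), the repaired `1`-unique perfection square (`PfSquareR`) over FSM-type bases**:
under the hypotheses of `thm34iii_pfSquare_of_isOfFSMType` (`PerfectionSquareFSM.lean`: quasi-isotropic
type, FSM-type bases, non-dilating divisor monoids, a non-group-like object on each side) and with `C₂` of
Frobenius-isotropic type (print's standing hypothesis for `C^pf`, Def. 3.1 (iii) p. 56), for THE perfections
`PreFrobenioidData.perfection hF_i` there is `Ψ^pf : C₁^pf ⥤ C₂^pf` which is an equivalence, makes the square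
with `C_i → C_i^pf` `1`-commute, and is unique up to isomorphism among the functors `B′` compatible with the
Frobenioid structures (arrows of Frobenius type to arrows of Frobenius type of the same degree) fitting into
the square — the three conjuncts of the typer's `PfSquareR` (seat abc-iut-L1-t3), spelled out.
[cite: MochizukiFrdI2008, Thm. 3.4 (iii) p.62] -/
theorem thm34iii_pfSquareR_of_isOfFSMType (hF₁ : PreFrobenioid.IsFrobenioid F₁)
    (hF₂ : PreFrobenioid.IsFrobenioid F₂) (hq₁ : (PreFrobenioidData.ofFunctor Φ₁ F₁).IsOfQuasiIsotropicType)
    (hq₂ : (PreFrobenioidData.ofFunctor Φ₂ F₂).IsOfQuasiIsotropicType) (hD₁ : IsOfFSMType D₁)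
    (hD₂ : IsOfFSMType D₂) (hnd₁ : (PreFrobenioidData.ofFunctor Φ₁ F₁).IsNonDilatingOn)
    (hnd₂ : (PreFrobenioidData.ofFunctor Φ₂ F₂).IsNonDilatingOn) (Ψ : C₁ ≌ C₂)
    (hN₁ : ∃ A : C₁, ¬ (PreFrobenioidData.ofFunctor Φ₁ F₁).IsGroupLikeObj A)
    (hN₂ : ∃ A : C₂, ¬ (PreFrobenioidData.ofFunctor Φ₂ F₂).IsGroupLikeObj A)
    (hiso₂ : PreFrobenioid.IsOfType (PreFrobenioid.IsFrobeniusIsotropic F₂)) :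
    ∃ Ψpf : (PreFrobenioidData.perfection hF₁).Pf ⥤ (PreFrobenioidData.perfection hF₂).Pf,
      Ψpf.IsEquivalence ∧
        OneCommutes Ψ.functor (PreFrobenioidData.perfection hF₂).toPf (PreFrobenioidData.perfection hF₁).toPf
          Ψpf ∧
        ∀ B' : (PreFrobenioidData.perfection hF₁).Pf ⥤ (PreFrobenioidData.perfection hF₂).Pf,
          PreFrobenioidData.PreservesMor B' (PreFrobenioidData.perfection hF₁).ops.IsFrobeniusType
              (PreFrobenioidData.perfection hF₂).ops.IsFrobeniusType →
            (∀ ⦃X Y : (PreFrobenioidData.perfection hF₁).Pf⦄ (f : X ⟶ Y),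
                (PreFrobenioidData.perfection hF₁).ops.IsFrobeniusType f →
                  (PreFrobenioidData.perfection hF₂).ops.degFr (B'.map f) =
                    (PreFrobenioidData.perfection hF₁).ops.degFr f) →
            OneCommutes Ψ.functor (PreFrobenioidData.perfection hF₂).toPf
                (PreFrobenioidData.perfection hF₁).toPf B' →
              Nonempty (B' ≅ Ψpf) := by
  have hΨ := isFrobeniusCompatible_of_isOfFSMType hF₁ hF₂ hq₁ hq₂ hD₁ hD₂ hnd₁ hnd₂ Ψ hN₁ hN₂
  exact ⟨PreFrobenioid.Perfection.map (hF₁ := hF₁) (hF₂ := hF₂) hΨ,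
    PreFrobenioid.Perfection.pfSquareR_map (hF₁ := hF₁) (hF₂ := hF₂) hiso₂ Ψ hΨ⟩

end FrdI

end Literature.AlgebraicGeometry.Frobenioids
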